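import Mathlib.Analysis.SpecialFunctions.SmoothTransition
import Mathlib.Analysis.SpecialFunctions.Trigonometric.Basic
import Mathlib.Analysis.SpecialFunctions.Trigonometric.Deriv
import Mathlib.Analysis.Calculus.MeanValue
import HarnessLib

/-!
# Cutoffs for periodic shears: a plateau, periodic bumps around `θ₀ + ℤ`, a height cutoff

Topic `Literature/Topology/FourManifolds`; real-analysis toolkit (explicit formulas, in the
spirit of `PlanarArch.lean`, `RadialStretch.lean`), first of two files constructing
height-preserving periodic shears of the plane (`PeriodicShear.lean`).  **Everything is proved;
the definitions are explicit formulas; no named facts.**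

* `PeriodicShear.shearPlateau t = 1 - smoothTransition (t - 1)` — smooth, `1` on `(-∞, 1]`,
  `0` on `[2, ∞)`, values in `[0, 1]`, bounded derivative (`exists_bound_deriv_plateau`);
* `PeriodicShear.shearBump η θ₀ θ = shearPlateau ((1 - cos (2π(θ - θ₀)))/η)` — a smooth
  `1`-periodic bump:
  `1` at `θ₀ + ℤ`, `0` at the points `θ` with `1 - cos(2π(θ - θ₀)) ≥ 2η` (in particular at any
  other prescribed point `θ₁` with `θ₁ - θ₀ ∉ ℤ`, once `2η ≤ 1 - cos(2π(θ₁ - θ₀))`), values in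
  `[0, 1]`, derivative bounded by a constant `C(η)` (`exists_bound_deriv_bump`);
* `PeriodicShear.shearHeightCut δ h = shearPlateau (h²/δ²)` — smooth, `1` for `|h| ≤ δ`, `0` for
  `|h| ≥ 2δ`, values in `[0, 1]`.

## References

Standard real analysis; all statements are `[folklore]`.  Mathlib: `Real.smoothTransition`.
-/

open Set Function Filter Metric Real
open scoped Topology ContDiff Real

noncomputable section

namespace Literature.Topology.FourManifolds

namespace PeriodicShear

/-! ### §1 A plateau cutoff -/

/-- The plateau cutoff `ϱ t = 1 - smoothTransition (t - 1)`: `1` on `(-∞, 1]`, `0` on `[2, ∞)`.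
[folklore] -/
def shearPlateau (t : ℝ) : ℝ := 1 - smoothTransition (t - 1)

/-- The plateau cutoff is smooth. [folklore] -/
theorem contDiff_plateau {n : ℕ∞} : ContDiff ℝ n shearPlateau :=
  contDiff_const.sub (smoothTransition.contDiff.comp (contDiff_id.sub contDiff_const))

/-- `ϱ = 1` on `(-∞, 1]`. [folklore] -/
theorem plateau_of_le_one {t : ℝ} (ht : t ≤ 1) : shearPlateau t = 1 := by
  rw [shearPlateau, smoothTransition.zero_of_nonpos (by linarith), sub_zero]

/-- `ϱ = 0` on `[2, ∞)`. [folklore] -/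
theorem plateau_of_two_le {t : ℝ} (ht : 2 ≤ t) : shearPlateau t = 0 := by
  rw [shearPlateau, smoothTransition.one_of_one_le (by linarith), sub_self]

/-- `0 ≤ ϱ ≤ 1`. [folklore] -/
theorem plateau_mem_Icc (t : ℝ) : shearPlateau t ∈ Icc (0 : ℝ) 1 := by
  constructor
  · rw [shearPlateau, sub_nonneg]; exact smoothTransition.le_one _
  · rw [shearPlateau, sub_le_self_iff]; exact smoothTransition.nonneg _

/-- The derivative of the plateau cutoff is bounded. [folklore] -/
theorem exists_bound_deriv_plateau : ∃ M : ℝ, 0 < M ∧ ∀ t, |deriv shearPlateau t| ≤ M := by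
  have hc : Continuous (deriv shearPlateau) := (contDiff_plateau (n := 1)).continuous_deriv (by simp)
  -- off `[1, 2]` the cutoff is locally constant, so the derivative vanishes
  have hzero : ∀ t, t ∉ Icc (1 : ℝ) 2 → deriv shearPlateau t = 0 := by
    intro t ht
    rw [mem_Icc, not_and_or, not_le, not_le] at ht
    rcases ht with ht | ht
    · have hev : shearPlateau =ᶠ[𝓝 t] fun _ => (1 : ℝ) := by
        filter_upwards [Iio_mem_nhds ht] with x hx
        exact plateau_of_le_one hx.le
      rw [hev.deriv_eq, deriv_const]
    · have hev : shearPlateau =ᶠ[𝓝 t] fun _ => (0 : ℝ) := by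
        filter_upwards [Ioi_mem_nhds ht] with x hx
        exact plateau_of_two_le hx.le
      rw [hev.deriv_eq, deriv_const]
  obtain ⟨M, hM⟩ :=
    isCompact_Icc.exists_bound_of_continuousOn (hc.continuousOn (s := Icc (1 : ℝ) 2))
  refine ⟨max M 1, by positivity, fun t => ?_⟩
  by_cases ht : t ∈ Icc (1 : ℝ) 2
  · exact (hM t ht).trans (le_max_left _ _)
  · rw [hzero t ht, abs_zero]; positivity

/-! ### §2 Periodic bumps around a point `θ₀ + ℤ` -/

/-- The periodic bump `λ(θ) = ϱ((1 - cos(2π(θ - θ₀)))/η)` around `θ₀ + ℤ`. [folklore] -/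
def shearBump (η θ₀ θ : ℝ) : ℝ := shearPlateau ((1 - cos (2 * π * (θ - θ₀))) / η)

variable {η θ₀ : ℝ}

/-- The bump is smooth. [folklore] -/
theorem contDiff_bump (η θ₀ : ℝ) {n : ℕ∞} : ContDiff ℝ n (shearBump η θ₀) :=
  contDiff_plateau.comp
    ((contDiff_const.sub (contDiff_cos.comp (contDiff_const.mul (contDiff_id.sub contDiff_const)))).div_const η)

/-- The bump is `1`-periodic. [folklore] -/
theorem bump_add_one (η θ₀ θ : ℝ) : shearBump η θ₀ (θ + 1) = shearBump η θ₀ θ := by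
  unfold shearBump
  congr 2
  rw [show 2 * π * (θ + 1 - θ₀) = 2 * π * (θ - θ₀) + 2 * π by ring, cos_add_two_pi]

/-- The bump is `1`-periodic (as a `Function.Periodic`). [folklore] -/
theorem periodic_bump (η θ₀ : ℝ) : Periodic (shearBump η θ₀) 1 := bump_add_one η θ₀

/-- The bump equals `1` at its centre. [folklore] -/
theorem bump_self (η θ₀ : ℝ) : shearBump η θ₀ θ₀ = 1 := by
  unfold shearBump
  rw [sub_self, mul_zero, cos_zero, sub_self, zero_div]
  exact plateau_of_le_one (by norm_num)

/-- The bump vanishes at points `θ` with `1 - cos(2π(θ - θ₀)) ≥ 2η`. [folklore] -/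
theorem bump_eq_zero (hη : 0 < η) {θ : ℝ} (h : 2 * η ≤ 1 - cos (2 * π * (θ - θ₀))) :
    shearBump η θ₀ θ = 0 := by
  unfold shearBump
  apply plateau_of_two_le
  rwa [le_div_iff₀ hη]

/-- `0 ≤ bump ≤ 1`. [folklore] -/
theorem bump_mem_Icc (η θ₀ θ : ℝ) : shearBump η θ₀ θ ∈ Icc (0 : ℝ) 1 := plateau_mem_Icc _

/-- The derivative of the bump is bounded (by the bound `M` on `ϱ'` times `2π/η`). [folklore] -/
theorem exists_bound_deriv_bump (hη : 0 < η) (θ₀ : ℝ) :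
    ∃ C : ℝ, 0 < C ∧ ∀ θ, |deriv (shearBump η θ₀) θ| ≤ C := by
  obtain ⟨M, hM, hMb⟩ := exists_bound_deriv_plateau
  refine ⟨M * (2 * π / η), by positivity, fun θ => ?_⟩
  -- chain rule
  set u : ℝ → ℝ := fun θ => (1 - cos (2 * π * (θ - θ₀))) / η with hu
  have hud : HasDerivAt u (2 * π * sin (2 * π * (θ - θ₀)) / η) θ := by
    have h1 : HasDerivAt (fun θ => 2 * π * (θ - θ₀)) (2 * π) θ := by
      simpa using ((hasDerivAt_id θ).sub_const θ₀).const_mul (2 * π)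
    have h2 := (hasDerivAt_cos _).comp θ h1
    have h3 : HasDerivAt (fun x => (1 - cos (2 * π * (x - θ₀))) / η)
        (-(-sin (2 * π * (θ - θ₀)) * (2 * π)) / η) θ := (h2.const_sub 1).div_const η
    refine h3.congr_deriv ?_
    ring
  have hpd : HasDerivAt shearPlateau (deriv shearPlateau (u θ)) (u θ) :=
    ((contDiff_plateau (n := 1)).differentiable (by simp) _).hasDerivAt
  have hcomp :
      HasDerivAt (shearBump η θ₀) (deriv shearPlateau (u θ) * (2 * π * sin (2 * π * (θ - θ₀)) / η)) θ :=
    hpd.comp θ hud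
  rw [hcomp.deriv, abs_mul]
  refine mul_le_mul (hMb _) ?_ (abs_nonneg _) hM.le
  rw [abs_div, abs_of_pos hη, div_le_div_iff_of_pos_right hη, abs_mul,
    abs_of_pos (by positivity : (0 : ℝ) < 2 * π)]
  exact mul_le_of_le_one_right (by positivity) (abs_sin_le_one _)

/-! ### §3 The height cutoff -/

/-- The height cutoff `κ(h) = ϱ(h²/δ²)`: `1` for `|h| ≤ δ`, `0` for `h² ≥ 2δ²`. [folklore] -/
def shearHeightCut (δ h : ℝ) : ℝ := shearPlateau (h ^ 2 / δ ^ 2)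

/-- The height cutoff is smooth. [folklore] -/
theorem contDiff_heightCut (δ : ℝ) {n : ℕ∞} : ContDiff ℝ n (shearHeightCut δ) :=
  contDiff_plateau.comp ((contDiff_id.pow 2).div_const _)

/-- `κ = 1` for `|h| ≤ δ` (`δ > 0`). [folklore] -/
theorem heightCut_of_abs_le {δ h : ℝ} (hδ : 0 < δ) (hh : |h| ≤ δ) : shearHeightCut δ h = 1 := by
  apply plateau_of_le_one
  rw [div_le_one (by positivity)]
  exact sq_le_sq' (by linarith [abs_le.1 hh]) (abs_le.1 hh).2

/-- `κ = 0` for `2δ ≤ |h|` (`δ > 0`). [folklore] -/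
theorem heightCut_of_le_abs {δ h : ℝ} (hδ : 0 < δ) (hh : 2 * δ ≤ |h|) : shearHeightCut δ h = 0 := by
  apply plateau_of_two_le
  rw [le_div_iff₀ (by positivity)]
  have h1 : (2 * δ) ^ 2 ≤ |h| ^ 2 := pow_le_pow_left₀ (by positivity) hh 2
  rw [sq_abs] at h1
  nlinarith

/-- If `κ h ≠ 0` then `|h| < 2δ` (`δ > 0`). [folklore] -/
theorem abs_lt_of_heightCut_ne_zero {δ h : ℝ} (hδ : 0 < δ) (hh : shearHeightCut δ h ≠ 0) :
    |h| < 2 * δ := by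
  by_contra hle
  exact hh (heightCut_of_le_abs hδ (not_lt.1 hle))

/-- `0 ≤ κ ≤ 1`. [folklore] -/
theorem heightCut_mem_Icc (δ h : ℝ) : shearHeightCut δ h ∈ Icc (0 : ℝ) 1 := plateau_mem_Icc _

end PeriodicShear

end Literature.Topology.FourManifolds

end
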